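import Mathlib

/-!
# Crux `BinomialElusive.BinomialCandidate` (stmt-ValiantsHypothesis-7392), line `registered` —
# helper for the stub `stub_integralPeeling`: degenerate data and the AFFINE corner

The registered stub `stub_integralPeeling` (integral half of the sibling crux `PeelingLemma`,
stmt-ValiantsHypothesis-7391) asks: for all large `m`, every quadratic `Γ : ℂ^{m-1} → ℂ^m` and every
power-series solution `p` of `Γ(p) = (t^{N a_i} + t^{N b_i})_i` force a nonzero integer relation
`Σ_i (u_i a_i + v_i b_i) = 0` of length `Σ_i (|u_i| + |v_i|) ≤ ⌊log₂ m⌋²`.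

This file lands two uniform-in-`m` pieces of that statement (both sorry-free, Mathlib only):

* `shortRelation_of_not_injective` — DEGENERATE DATA.  If the `2m` exponents `a_i, b_i` are not
  pairwise distinct (`Sum.elim a b` not injective: some `a_i = b_j`, or `a_i = a_j` / `b_i = b_j`
  with `i ≠ j`), there is a relation of length `2 ≤ ⌊log₂ m⌋²` as soon as `m ≥ 4`.  So every attack
  on the stub may assume pairwise distinct exponents.
* `affine_no_solution` — the AFFINE CORNER (`totalDegree (Γ i) ≤ 1`, any number `n < m` of
  variables, any LAURENT solution, integral or not): impossible for pairwise distinct exponents.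
  Proof: write `Γ_i = κ_i + Σ_j ℓ_{ij} y_j` (`eq_affine_of_totalDegree_le_one`); a nonzero
  left-kernel vector `λ` of the `m × n` matrix `ℓ` (`exists_ne_zero_leftKernel`, strong rank
  condition) gives `Σ_i λ_i T_i = (Σ_i λ_i κ_i) · 1` for `T_i = t^{N a_i} + t^{N b_i}`; reading off
  the coefficient of a nonzero exponent of `T_{i₀}` (one of `N a_{i₀} ≠ N b_{i₀}` is nonzero), which
  occurs in no other `T_i` and not in `1`, gives `λ_{i₀} = 0` for every `i₀` — contradiction.
* `integralPeeling_affine` — the two combined in the exact shape of the stub with `totalDegree ≤ 1`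
  in place of `≤ 2` (explicit threshold `m ≥ 4`, no integrality hypothesis needed).

Source of the line: Garg–Makam–Oliveira–Wigderson 2019 (arXiv:1904.04299) §9 (Lemma 9.3,
Prop. 9.8); the affine corner is the rank count `m` outputs versus `n < m` inputs plus linear
independence of binomials with pairwise distinct supports (folklore).  NOT here: anything about
genuinely quadratic `Γ` (the monomial corner is the route's `ToricBinomialElusive`; the honest and
cancellative quadratic cases are the open content of the stub).
-/

-- layout Summits/ValiantsHypothesis/ValiantsHypothesis forces the duplicated namespace component
set_option linter.dupNamespace false

namespace Summit.ValiantsHypothesis.ValiantsHypothesis.Theorems.BinomialCandidateStubs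

open scoped BigOperators

namespace AffinePeeling

/-! ## Degenerate data: a relation of length `2` -/

/-- `m ≥ 4` gives `2 ≤ ⌊log₂ m⌋²` (as an integer inequality, the form the stub's length bound takes). -/
theorem two_le_log_sq {m : ℕ} (hm : 4 ≤ m) : (2 : ℤ) ≤ ((Nat.log 2 m ^ 2 : ℕ) : ℤ) := by
  have h2 : 2 ≤ Nat.log 2 m := Nat.le_log_of_pow_le (by norm_num) (by simpa using hm)
  have h4 : 4 ≤ Nat.log 2 m ^ 2 := by nlinarith
  omega

/-- Packaging: a nonzero pair `(u, v)` of length `≤ 2` realising a relation is a witness for the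
stub's conclusion once `m ≥ 4`. -/
theorem shortRelation_of_length_le_two {m : ℕ} (hm : 4 ≤ m) (a b : Fin m → ℕ) (u v : Fin m → ℤ)
    (hne : (u, v) ≠ 0) (hlen : ∑ i, (|u i| + |v i|) ≤ 2)
    (hrel : ∑ i, (u i * (a i : ℤ) + v i * (b i : ℤ)) = 0) :
    ∃ u v : Fin m → ℤ, (u, v) ≠ 0 ∧ ∑ i, (|u i| + |v i|) ≤ ((Nat.log 2 m ^ 2 : ℕ) : ℤ) ∧
      ∑ i, (u i * (a i : ℤ) + v i * (b i : ℤ)) = 0 :=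
  ⟨u, v, hne, hlen.trans (two_le_log_sq hm), hrel⟩

/-- A coincidence `a i = b j` (possibly `i = j`) is the relation `a i - b j = 0` of length `2`. -/
theorem shortRelation_of_a_eq_b {m : ℕ} (hm : 4 ≤ m) (a b : Fin m → ℕ) {i j : Fin m}
    (h : a i = b j) :
    ∃ u v : Fin m → ℤ, (u, v) ≠ 0 ∧ ∑ i, (|u i| + |v i|) ≤ ((Nat.log 2 m ^ 2 : ℕ) : ℤ) ∧
      ∑ i, (u i * (a i : ℤ) + v i * (b i : ℤ)) = 0 := by
  classical
  refine shortRelation_of_length_le_two hm a b (Pi.single i 1) (-Pi.single j 1) ?_ ?_ ?_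
  · intro h0
    have := congr_arg (fun q : (Fin m → ℤ) × (Fin m → ℤ) => q.1 i) h0
    simp at this
  · rw [Finset.sum_add_distrib]
    have h1 : ∑ k, |(Pi.single i (1 : ℤ) : Fin m → ℤ) k| = 1 := by
      simp [Pi.single_apply, apply_ite abs]
    have h2 : ∑ k, |(-Pi.single j (1 : ℤ) : Fin m → ℤ) k| = 1 := by
      simp [Pi.single_apply, apply_ite abs, apply_ite Neg.neg]
    omega
  · simp [Pi.single_apply, ite_mul, Finset.sum_add_distrib, h]

/-- A repetition `a i = a j` with `i ≠ j` is the relation `a i - a j = 0` of length `2`. -/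
theorem shortRelation_of_a_eq_a {m : ℕ} (hm : 4 ≤ m) (a b : Fin m → ℕ) {i j : Fin m} (hij : i ≠ j)
    (h : a i = a j) :
    ∃ u v : Fin m → ℤ, (u, v) ≠ 0 ∧ ∑ i, (|u i| + |v i|) ≤ ((Nat.log 2 m ^ 2 : ℕ) : ℤ) ∧
      ∑ i, (u i * (a i : ℤ) + v i * (b i : ℤ)) = 0 := by
  classical
  refine shortRelation_of_length_le_two hm a b (Pi.single i 1 - Pi.single j 1) 0 ?_ ?_ ?_
  · intro h0
    have := congr_arg (fun q : (Fin m → ℤ) × (Fin m → ℤ) => q.1 i) h0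
    simp [hij] at this
  · have h1 : ∀ k, |(Pi.single i 1 - Pi.single j 1 : Fin m → ℤ) k| ≤
        |(Pi.single i (1 : ℤ) : Fin m → ℤ) k| + |(Pi.single j (1 : ℤ) : Fin m → ℤ) k| := fun k => by
      rw [Pi.sub_apply]; exact abs_sub _ _
    have h2 : ∑ k, |(Pi.single i (1 : ℤ) : Fin m → ℤ) k| = 1 := by
      simp [Pi.single_apply, apply_ite abs]
    have h3 : ∑ k, |(Pi.single j (1 : ℤ) : Fin m → ℤ) k| = 1 := by
      simp [Pi.single_apply, apply_ite abs]
    calc ∑ k, (|(Pi.single i 1 - Pi.single j 1 : Fin m → ℤ) k| + |(0 : Fin m → ℤ) k|)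
        = ∑ k, |(Pi.single i 1 - Pi.single j 1 : Fin m → ℤ) k| := by simp
      _ ≤ ∑ k, (|(Pi.single i (1 : ℤ) : Fin m → ℤ) k| + |(Pi.single j (1 : ℤ) : Fin m → ℤ) k|) :=
          Finset.sum_le_sum fun k _ => h1 k
      _ = 2 := by rw [Finset.sum_add_distrib, h2, h3]; rfl
      _ ≤ 2 := le_rfl
  · simp [Pi.single_apply, sub_mul, ite_mul, Finset.sum_sub_distrib, h]

/-- **Degenerate data.**  If the `2m` exponents `a_i, b_i` are not pairwise distinct, the stub's
conclusion holds with a relation of length `2` (`m ≥ 4`). -/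
theorem shortRelation_of_not_injective {m : ℕ} (hm : 4 ≤ m) (a b : Fin m → ℕ)
    (h : ¬ Function.Injective (Sum.elim a b)) :
    ∃ u v : Fin m → ℤ, (u, v) ≠ 0 ∧ ∑ i, (|u i| + |v i|) ≤ ((Nat.log 2 m ^ 2 : ℕ) : ℤ) ∧
      ∑ i, (u i * (a i : ℤ) + v i * (b i : ℤ)) = 0 := by
  rw [Sum.elim_injective] at h
  by_cases ha : Function.Injective a
  · by_cases hb : Function.Injective b
    · have hab : ¬ ∀ i j, a i ≠ b j := fun h' => h ⟨ha, hb, h'⟩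
      push Not at hab
      obtain ⟨i, j, hij⟩ := hab
      exact shortRelation_of_a_eq_b hm a b hij
    · obtain ⟨i, j, hbij, hij⟩ := Function.not_injective_iff.mp hb
      -- swap the roles of `a` and `b`
      obtain ⟨u, v, hne, hlen, hrel⟩ := shortRelation_of_a_eq_a hm b a hij hbij
      refine ⟨v, u, fun h0 => hne ?_, ?_, ?_⟩
      · have h1 : v = 0 := congr_arg Prod.fst h0
        have h2 : u = 0 := congr_arg Prod.snd h0
        rw [h1, h2]; rfl
      · simpa only [add_comm] using hlen
      · simpa only [add_comm] using hrel
  · obtain ⟨i, j, haij, hij⟩ := Function.not_injective_iff.mp ha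
    exact shortRelation_of_a_eq_a hm a b hij haij

/-! ## The affine corner -/

/-- A finitely supported `s : σ →₀ ℕ` of degree `≤ 1` is `0` or some `single j 1`. -/
theorem finsupp_eq_zero_or_single_of_degree_le_one {σ : Type*} (s : σ →₀ ℕ)
    (hs : (s.sum fun _ e => e) ≤ 1) : s = 0 ∨ ∃ j, s = Finsupp.single j 1 := by
  classical
  by_cases h0 : s = 0
  · exact Or.inl h0
  right
  obtain ⟨j, hj⟩ := Finsupp.support_nonempty_iff.mpr h0
  have hj' : s j ≠ 0 := Finsupp.mem_support_iff.mp hj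
  have hsum : (s.sum fun _ e => e) = s j + ∑ k ∈ s.support.erase j, s k := by
    unfold Finsupp.sum
    rw [Finset.add_sum_erase _ _ hj]
  have hsj : s j = 1 := by omega
  have hrest : ∑ k ∈ s.support.erase j, s k = 0 := by omega
  refine ⟨j, Finsupp.ext fun k => ?_⟩
  by_cases hk : k = j
  · subst hk; simp [hsj]
  · rw [Finsupp.single_apply, if_neg (Ne.symm hk)]
    by_contra hk0
    have hmem : k ∈ s.support.erase j := Finset.mem_erase.mpr ⟨hk, Finsupp.mem_support_iff.mpr hk0⟩
    have := Finset.sum_eq_zero_iff.mp hrest k hmem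
    exact hk0 this

/-- Affine normal form: a polynomial of total degree `≤ 1` in finitely many variables is
`C (coeff 0 f) + Σ_j C (coeff (single j 1) f) * X j`. -/
theorem eq_affine_of_totalDegree_le_one {σ R : Type*} [Fintype σ] [DecidableEq σ] [CommSemiring R]
    (f : MvPolynomial σ R) (hf : f.totalDegree ≤ 1) :
    f = MvPolynomial.C (f.coeff 0) + ∑ j, MvPolynomial.C (f.coeff (Finsupp.single j 1)) * MvPolynomial.X j := by
  classical
  refine MvPolynomial.ext _ _ fun d => ?_
  rw [MvPolynomial.coeff_add, MvPolynomial.coeff_C, MvPolynomial.coeff_sum]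
  simp only [MvPolynomial.coeff_C_mul, MvPolynomial.coeff_X]
  by_cases hd : d ∈ f.support
  · rcases finsupp_eq_zero_or_single_of_degree_le_one d ((MvPolynomial.le_totalDegree hd).trans hf)
      with rfl | ⟨j, rfl⟩
    · have : ∀ x : σ, (Finsupp.single x 1 : σ →₀ ℕ) ≠ 0 := fun x => by simp
      simp [this]
    · have hne : (0 : σ →₀ ℕ) ≠ Finsupp.single j 1 := (Finsupp.single_ne_zero.mpr one_ne_zero).symm
      rw [if_neg hne, zero_add, Finset.sum_eq_single j]
      · simp
      · intro k _ hkj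
        rw [if_neg, mul_zero]
        exact fun h => hkj (Finsupp.single_left_injective one_ne_zero h)
      · simp
  · have hd0 : f.coeff d = 0 := by simpa [MvPolynomial.mem_support_iff] using hd
    rw [hd0]
    symm
    have h1 : (if 0 = d then f.coeff 0 else 0) = 0 := by
      split_ifs with h
      · subst h; exact hd0
      · rfl
    rw [h1, zero_add]
    refine Finset.sum_eq_zero fun k _ => ?_
    split_ifs with h
    · subst h; rw [hd0, zero_mul]
    · rw [mul_zero]

/-- Evaluation of an affine polynomial:
`aeval p f = algebraMap (coeff 0 f) + Σ_j algebraMap (coeff (single j 1) f) * p j`. -/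
theorem aeval_eq_of_totalDegree_le_one {σ R A : Type*} [Fintype σ] [DecidableEq σ] [CommSemiring R]
    [CommSemiring A] [Algebra R A] (f : MvPolynomial σ R) (hf : f.totalDegree ≤ 1) (p : σ → A) :
    MvPolynomial.aeval p f =
      algebraMap R A (f.coeff 0) + ∑ j, algebraMap R A (f.coeff (Finsupp.single j 1)) * p j := by
  conv_lhs => rw [eq_affine_of_totalDegree_le_one f hf]
  simp only [map_add, map_sum, map_mul, MvPolynomial.aeval_C, MvPolynomial.aeval_X]

/-- In `ℂ((t))` (with the `ℂ`-algebra structure Mathlib synthesises, through `PowerSeries ℂ`),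
`algebraMap ℂ ℂ((t)) r` is the constant series `single 0 r`. -/
theorem algebraMap_laurentSeries_apply (r : ℂ) :
    algebraMap ℂ (LaurentSeries ℂ) r = HahnSeries.single 0 r := by
  rw [HahnSeries.algebraMap_apply']
  simp

/-- Left-kernel vectors: an `m × n` matrix over a commutative ring with the strong rank condition,
`n < m`, has a nonzero `l` with `∑_i l_i E_ij = 0` for all `j`. -/
theorem exists_ne_zero_leftKernel {R : Type*} [CommRing R] [StrongRankCondition R] {m n : ℕ}
    (hnm : n < m) (E : Fin m → Fin n → R) :
    ∃ l : Fin m → R, l ≠ 0 ∧ ∀ j, ∑ i, l i * E i j = 0 := by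
  let L : (Fin m → R) →ₗ[R] (Fin n → R) :=
    { toFun := fun l j => ∑ i, l i * E i j
      map_add' := by
        intro x y; funext j
        simp only [Pi.add_apply, add_mul, Finset.sum_add_distrib]
      map_smul' := by
        intro r x; funext j
        simp only [Pi.smul_apply, smul_eq_mul, RingHom.id_apply, Finset.mul_sum, mul_assoc] }
  have hnotinj : ¬ Function.Injective L := fun h =>
    absurd (le_of_fin_injective R L h) (not_le.mpr hnm)
  rw [injective_iff_map_eq_zero] at hnotinj
  push Not at hnotinj
  obtain ⟨l, hl0, hlne⟩ := hnotinj
  exact ⟨l, hlne, fun j => congr_fun hl0 j⟩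

/-- The coefficient of `t^e`, `e = N c`, in the binomial `t^{N a} + t^{N b}`, for `N > 0`:
`[c = a] + [c = b]`. -/
theorem coeff_binomial {N : ℕ} (hN : 0 < N) (a b c : ℕ) :
    (HahnSeries.single ((N * a : ℕ) : ℤ) (1 : ℂ) + HahnSeries.single ((N * b : ℕ) : ℤ) (1 : ℂ)).coeff
        ((N * c : ℕ) : ℤ) = (if c = a then 1 else 0) + (if c = b then 1 else 0) := by
  rw [HahnSeries.coeff_add, HahnSeries.coeff_single, HahnSeries.coeff_single]
  have key : ∀ x : ℕ, (((N * c : ℕ) : ℤ) = ((N * x : ℕ) : ℤ)) ↔ c = x := fun x => by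
    rw [Nat.cast_inj]
    exact ⟨fun h => Nat.eq_of_mul_eq_mul_left hN h, fun h => by rw [h]⟩
  simp only [key]

/-- **The affine corner.**  With pairwise distinct exponents (`Sum.elim a b` injective), `n < m`
variables and `totalDegree (Γ i) ≤ 1`, the system `Γ(p) = (t^{N a_i} + t^{N b_i})_i` has NO Laurent
series solution at all. -/
theorem affine_no_solution {m n : ℕ} (hnm : n < m) (a b : Fin m → ℕ)
    (hab : Function.Injective (Sum.elim a b)) (Γ : Fin m → MvPolynomial (Fin n) ℂ)
    (hΓ : ∀ i, (Γ i).totalDegree ≤ 1) (N : ℕ) (hN : 0 < N) (p : Fin n → LaurentSeries ℂ)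
    (hp : ∀ i, MvPolynomial.aeval p (Γ i) =
      HahnSeries.single ((N * a i : ℕ) : ℤ) (1 : ℂ) + HahnSeries.single ((N * b i : ℕ) : ℤ) (1 : ℂ)) :
    False := by
  classical
  obtain ⟨hinja, hinjb, hab'⟩ := Sum.elim_injective.mp hab
  -- affine data `Γ_i = κ_i + Σ_j ℓ_ij y_j`
  let κ : Fin m → ℂ := fun i => (Γ i).coeff 0
  let ℓ : Fin m → Fin n → ℂ := fun i j => (Γ i).coeff (Finsupp.single j 1)
  have haff : ∀ i, HahnSeries.single ((N * a i : ℕ) : ℤ) (1 : ℂ) + HahnSeries.single ((N * b i : ℕ) : ℤ) (1 : ℂ)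
      = HahnSeries.single 0 (κ i) + ∑ j, HahnSeries.single 0 (ℓ i j) * p j := fun i => by
    rw [← hp i, aeval_eq_of_totalDegree_le_one (Γ i) (hΓ i) p]
    simp only [algebraMap_laurentSeries_apply, κ, ℓ]
  -- left kernel vector `l ≠ 0` of `ℓ`
  obtain ⟨l, hlne, hlker⟩ := exists_ne_zero_leftKernel hnm ℓ
  have hcomb : ∑ i, l i • (HahnSeries.single ((N * a i : ℕ) : ℤ) (1 : ℂ) +
      HahnSeries.single ((N * b i : ℕ) : ℤ) (1 : ℂ)) = HahnSeries.single 0 (∑ i, l i * κ i) := by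
    have h1 : ∀ i, l i • (HahnSeries.single ((N * a i : ℕ) : ℤ) (1 : ℂ) +
        HahnSeries.single ((N * b i : ℕ) : ℤ) (1 : ℂ)) =
        HahnSeries.single (0 : ℤ) (l i * κ i) + ∑ j, (l i * ℓ i j) • p j := fun i => by
      rw [haff i, smul_add, Finset.smul_sum]
      congr 1
      · rw [← HahnSeries.single_zero_mul_eq_smul, HahnSeries.single_mul_single, zero_add]
      · refine Finset.sum_congr rfl fun j _ => ?_
        rw [HahnSeries.single_zero_mul_eq_smul, smul_smul]
    have h2 : ∑ i, ∑ j, (l i * ℓ i j) • p j = 0 := by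
      rw [Finset.sum_comm]
      refine Finset.sum_eq_zero fun j _ => ?_
      rw [← Finset.sum_smul, hlker j, zero_smul]
    have h3 : ∑ i, HahnSeries.single (0 : ℤ) (l i * κ i) = HahnSeries.single 0 (∑ i, l i * κ i) := by
      rw [← HahnSeries.C_apply, map_sum]
      exact Finset.sum_congr rfl fun i _ => (HahnSeries.C_apply _).symm
    simp only [h1, Finset.sum_add_distrib, h2, add_zero, h3]
  -- coefficient extraction at a nonzero private exponent `N c`, `c ∈ {a i, b i}`
  have key : ∀ i (c : ℕ), c ≠ 0 → (c = a i ∨ c = b i) → l i = 0 := by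
    intro i c hc hcab
    have h := congr_arg (fun x : LaurentSeries ℂ => x.coeff ((N * c : ℕ) : ℤ)) hcomb
    have hNc : ((N * c : ℕ) : ℤ) ≠ 0 := by
      have : N * c ≠ 0 := Nat.mul_ne_zero hN.ne' hc
      exact_mod_cast this
    simp only [HahnSeries.coeff_sum, HahnSeries.coeff_smul, smul_eq_mul,
      HahnSeries.coeff_single_of_ne hNc] at h
    rw [Finset.sum_eq_single i] at h
    · rw [coeff_binomial hN] at h
      have hne : a i ≠ b i := fun e => hab' i i e
      rcases hcab with rfl | rfl
      · have : ¬ a i = b i := hne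
        simpa [this] using h
      · have : ¬ b i = a i := fun e => hne e.symm
        simpa [this] using h
    · intro k _ hki
      rw [coeff_binomial hN]
      have h1 : c ≠ a k := by
        rcases hcab with rfl | rfl
        · exact fun e => hki (hinja e.symm)
        · exact fun e => hab' k i e.symm
      have h2 : c ≠ b k := by
        rcases hcab with rfl | rfl
        · exact fun e => hab' i k e
        · exact fun e => hki (hinjb e.symm)
      simp [h1, h2]
    · simp
  obtain ⟨i₀, hi₀⟩ := Function.ne_iff.mp hlne
  by_cases ha0 : a i₀ = 0
  · have hb0 : b i₀ ≠ 0 := fun e => hab' i₀ i₀ (ha0.trans e.symm)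
    exact hi₀ (key i₀ (b i₀) hb0 (Or.inr rfl))
  · exact hi₀ (key i₀ (a i₀) ha0 (Or.inl rfl))

end AffinePeeling

/-- **`stub_integralPeeling`, affine corner** (uniform in `m ≥ 4`, no integrality needed): the
registered stub's statement with `totalDegree (Γ i) ≤ 1` in place of `≤ 2`.  Degenerate data give a
relation of length `2`; for pairwise distinct exponents an affine `Γ` on `m - 1 < m` variables has no
Laurent solution (`AffinePeeling.affine_no_solution`). -/
theorem integralPeeling_affine :
    ∀ m ≥ 4, ∀ (a b : Fin m → ℕ) (Γ : Fin m → MvPolynomial (Fin (m - 1)) ℂ) (N : ℕ)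
      (p : Fin (m - 1) → LaurentSeries ℂ), (∀ i, (Γ i).totalDegree ≤ 1) → 0 < N →
      (∀ i, MvPolynomial.aeval p (Γ i) =
        HahnSeries.single ((N * a i : ℕ) : ℤ) (1 : ℂ) + HahnSeries.single ((N * b i : ℕ) : ℤ) (1 : ℂ)) →
      ∃ u v : Fin m → ℤ, (u, v) ≠ 0 ∧ ∑ i, (|u i| + |v i|) ≤ ((Nat.log 2 m ^ 2 : ℕ) : ℤ) ∧
        ∑ i, (u i * (a i : ℤ) + v i * (b i : ℤ)) = 0 := by
  intro m hm a b Γ N p hΓ hN hp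
  by_cases hab : Function.Injective (Sum.elim a b)
  · exact (AffinePeeling.affine_no_solution (by omega) a b hab Γ hΓ N hN p hp).elim
  · exact AffinePeeling.shortRelation_of_not_injective hm a b hab

/-- The affine corner in the stub's literal `∃ m₀` shape (witness `m₀ = 4`). -/
theorem integralPeeling_affine_eventually :
    ∃ m₀ : ℕ, ∀ m ≥ m₀, ∀ (a b : Fin m → ℕ) (Γ : Fin m → MvPolynomial (Fin (m - 1)) ℂ) (N : ℕ)
      (p : Fin (m - 1) → LaurentSeries ℂ), (∀ i, (Γ i).totalDegree ≤ 1) → 0 < N →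
      (∀ j, 0 ≤ (p j).order) →
      (∀ i, MvPolynomial.aeval p (Γ i) =
        HahnSeries.single ((N * a i : ℕ) : ℤ) (1 : ℂ) + HahnSeries.single ((N * b i : ℕ) : ℤ) (1 : ℂ)) →
      ∃ u v : Fin m → ℤ, (u, v) ≠ 0 ∧ ∑ i, (|u i| + |v i|) ≤ ((Nat.log 2 m ^ 2 : ℕ) : ℤ) ∧
        ∑ i, (u i * (a i : ℤ) + v i * (b i : ℤ)) = 0 :=
  ⟨4, fun m hm a b Γ N p hΓ hN _ hp => integralPeeling_affine m hm a b Γ N p hΓ hN hp⟩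

end Summit.ValiantsHypothesis.ValiantsHypothesis.Theorems.BinomialCandidateStubs
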